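import Mathlib
import Summits.KontsevichZagierPeriods.Zeta5Search.FlagRayCasLB
import HarnessLib

/-!
# ζ(5) search — `N_p`, the refund and ⌊d/p⌋ on the band-60 FLAG ray; DOMINANCE of (CV) and (CV) itself for every prime `p > 13n`, all `n` (part 2)

Cell `pub-zeta5` (HONEST FRAMING: systematic search; no irrationality claim unless certified), TRACK «DENOM-LAW» D1 prover seat
(denom-prover-d1 g12, `HOME/denom-law/prover-d1/ATTEMPT-12.md`).  On the band-60 FLAG ray `b(n) = n·(60; 25,24,22,21,19,18,16)`
(`bRay [60,25,24,22,21,19,18,16] n`; direction `(11,24,14,22,17,23,26,19)`, `d = 35n`; first period ⟺ `p > 13n`) the class-type covers of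
`FlagRayCellsA–H` give the EXACT value of the tree's Casoratian class bound on each θ-cell (`θ = p/n`):
`casLB ≥ −11, −9, −9, −7, −6, −6, −6, −5, −5, −3, −1, 0, 1, 0` on `(13,14], (14,15], (15,16], (16,17], (17,17.5], (17.5,18], (18,19], (19,20],
(20,21], (22,23], (23,25], (25,26], (26,35], (35,60]` (all attained: brute force `n ≤ 12`), and `casLB ≥ 0` beyond the support (`p > 60n`, singleton
classes).  With the closed forms of `N_p` (`pairFloors_flag`) and of the refund this yields the DOMINANCE `refund − N_p ≤ casLB` at every prime
`p > 13n` OFF the band `21n < p < 22n` (there `casLB = −5 < −4 = refund − N_p`; the band is the tree's `StairCellFLAGa`, double-drop bonus), and hence —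
`FlagRayCV` below — (CV) `v_p(Cas_j(b(n))) ≥ refund − N_p` for every `n ≥ 1`, every `1 ≤ j ≤ 7` and every prime `p > 13n` (THEOREM LB
`casoratianClassBound_holds`; on the band the double-drop bonus read `j`-generically from the tree's cover `StairFLAG.cover_a`).
MODEL/structure-side integer bookkeeping on the cell's own class data; nothing about ζ(5); no γ; records in print UNMOVED.
-/

open Finset

namespace Summit.KontsevichZagierPeriods.Zeta5Search.StairFLAG

open Summit.KontsevichZagierPeriods.Zeta5Search.ClusterValuation
open Summit.KontsevichZagierPeriods.Zeta5Search.CasoratianValuation (InPolytope shift casoratian pairFloors refund)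
open Summit.KontsevichZagierPeriods.Zeta5Search.WedgeDictionary (dOf)
open Summit.KontsevichZagierPeriods.Zeta5Search.ClassTypeCover
open Summit.KontsevichZagierPeriods.Zeta5Search.StaircaseCells

/-! ## §2 The refund, `⌊d/p⌋` and `N_p` on the ray -/

section Arith
variable {n p : ℕ}

/-- `refund = 1` for `p ≤ 35n = d`. -/
theorem refund_ray_one (hp0 : 0 < p) (h : p ≤ 35 * n) : refund (bRay [60, 25, 24, 22, 21, 19, 18, 16] n) p = 1 := by
  unfold refund; rw [dOf_ray]; apply min_eq_left
  rw [Int.le_ediv_iff_mul_le (by exact_mod_cast hp0)]; push_cast; omega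

/-- `refund = 0` for `p > 35n`. -/
theorem refund_ray_zero (h : 35 * n < p) : refund (bRay [60, 25, 24, 22, 21, 19, 18, 16] n) p = 0 := by
  unfold refund; rw [dOf_ray, Int.ediv_eq_zero_of_lt (by positivity) (by push_cast; omega)]; norm_num

/-- `⌊d/p⌋ = 2` for `35n < 3p`, `2p ≤ 35n`. -/
theorem dOf_div_two (h1 : 35 * n < 3 * p) (h2 : 2 * p ≤ 35 * n) : dOf (bRay [60, 25, 24, 22, 21, 19, 18, 16] n) / (p : ℤ) = 2 := by
  have hp0 : (0 : ℤ) < p := by exact_mod_cast (show 0 < p by omega)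
  rw [dOf_ray]; push_cast
  apply le_antisymm
  · have : (35 * (n : ℤ)) / (p : ℤ) < 3 := by rw [Int.ediv_lt_iff_lt_mul hp0]; omega
    omega
  · rw [Int.le_ediv_iff_mul_le hp0]; omega

/-- `⌊d/p⌋ = 1` for `35n < 2p`, `p ≤ 35n`. -/
theorem dOf_div_one (h1 : 35 * n < 2 * p) (h2 : p ≤ 35 * n) : dOf (bRay [60, 25, 24, 22, 21, 19, 18, 16] n) / (p : ℤ) = 1 := by
  have hp0 : (0 : ℤ) < p := by exact_mod_cast (show 0 < p by omega)
  rw [dOf_ray]; push_cast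
  apply le_antisymm
  · have : (35 * (n : ℤ)) / (p : ℤ) < 2 := by rw [Int.ediv_lt_iff_lt_mul hp0]; omega
    omega
  · rw [Int.le_ediv_iff_mul_le hp0]; omega

/-- `⌊d/p⌋ = 0` for `p > 35n`. -/
theorem dOf_div_zero (h : 35 * n < p) : dOf (bRay [60, 25, 24, 22, 21, 19, 18, 16] n) / (p : ℤ) = 0 := by
  rw [dOf_ray]; exact Int.ediv_eq_zero_of_lt (by positivity) (by push_cast; omega)

/-- **`N_p` on the first-period ray** (`p > 13n`; the 21 pair blocks are `c·n` with `c ∈ {11,13,14,14,15,16,17,17,17,18,19,19,20,20,20,21,22,23,23,25,26}`,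
each `< 2p`): `N_p = 2[p≤14n] + [p≤15n] + [p≤16n] + 3[p≤17n] + [p≤18n] + 2[p≤19n] + 3[p≤20n] + [p≤21n] + [p≤22n] + 2[p≤23n] + [p≤25n] + [p≤26n]`. -/
theorem pairFloors_flag (hp : 13 * n < p) :
    pairFloors (bRay [60, 25, 24, 22, 21, 19, 18, 16] n) p =
      2 * (if p ≤ 14 * n then 1 else 0) + (if p ≤ 15 * n then 1 else 0) + (if p ≤ 16 * n then 1 else 0) +
      3 * (if p ≤ 17 * n then 1 else 0) + (if p ≤ 18 * n then 1 else 0) + 2 * (if p ≤ 19 * n then 1 else 0) +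
      3 * (if p ≤ 20 * n then 1 else 0) + (if p ≤ 21 * n then 1 else 0) + (if p ≤ 22 * n then 1 else 0) +
      2 * (if p ≤ 23 * n then 1 else 0) + (if p ≤ 25 * n then 1 else 0) + (if p ≤ 26 * n then 1 else 0) := by
  have hp0 : (0 : ℤ) < p := by exact_mod_cast (show 0 < p by omega)
  have hq0 : ∀ (a b : ℤ), 0 ≤ (n : ℤ) * 60 - (n : ℤ) * a - (n : ℤ) * b → (n : ℤ) * 60 - (n : ℤ) * a - (n : ℤ) * b < p →
      ((n : ℤ) * 60 - (n : ℤ) * a - (n : ℤ) * b) / (p : ℤ) = 0 := fun a b h0 h1 => Int.ediv_eq_zero_of_lt h0 h1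
  have hq1 : ∀ (a b : ℤ) (c : ℕ), (60 : ℤ) - a - b = c → c * n < 2 * p →
      ((n : ℤ) * 60 - (n : ℤ) * a - (n : ℤ) * b) / (p : ℤ) = if p ≤ c * n then 1 else 0 := by
    intro a b c h h2
    rw [show (n : ℤ) * 60 - (n : ℤ) * a - (n : ℤ) * b = (c : ℤ) * n by rw [← h]; ring]
    split_ifs with hc
    · rw [Int.ediv_eq_iff_of_pos hp0]; constructor <;> nlinarith
    · exact Int.ediv_eq_zero_of_lt (by positivity) (by nlinarith)
  -- keep the right-hand side opaque (`R`) while `norm_num` normalises the 21 pair blocks on the left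
  suffices hR : ∀ R : ℤ,
      2 * (if p ≤ 14 * n then 1 else 0) + (if p ≤ 15 * n then 1 else 0) + (if p ≤ 16 * n then 1 else 0) +
      3 * (if p ≤ 17 * n then 1 else 0) + (if p ≤ 18 * n then 1 else 0) + 2 * (if p ≤ 19 * n then 1 else 0) +
      3 * (if p ≤ 20 * n then 1 else 0) + (if p ≤ 21 * n then 1 else 0) + (if p ≤ 22 * n then 1 else 0) +
      2 * (if p ≤ 23 * n then 1 else 0) + (if p ≤ 25 * n then 1 else 0) + (if p ≤ 26 * n then 1 else 0) = R →
      pairFloors (bRay [60, 25, 24, 22, 21, 19, 18, 16] n) p = R from hR _ rfl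
  intro R hR
  unfold pairFloors
  simp only [sum_range_succ, sum_range_zero, zero_add, Nat.reduceAdd, v0, v1, v2, v3, v4, v5, v6, v7]
  norm_num
  rw [hq0 25 24 (by omega) (by omega), hq0 25 22 (by omega) (by omega),
      hq1 25 21 14 (by norm_num) (by omega), hq1 25 19 16 (by norm_num) (by omega), hq1 25 18 17 (by norm_num) (by omega),
      hq1 25 16 19 (by norm_num) (by omega), hq1 24 22 14 (by norm_num) (by omega), hq1 24 21 15 (by norm_num) (by omega),
      hq1 24 19 17 (by norm_num) (by omega), hq1 24 18 18 (by norm_num) (by omega), hq1 24 16 20 (by norm_num) (by omega),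
      hq1 22 21 17 (by norm_num) (by omega), hq1 22 19 19 (by norm_num) (by omega), hq1 22 18 20 (by norm_num) (by omega),
      hq1 22 16 22 (by norm_num) (by omega), hq1 21 19 20 (by norm_num) (by omega), hq1 21 18 21 (by norm_num) (by omega),
      hq1 21 16 23 (by norm_num) (by omega), hq1 19 18 23 (by norm_num) (by omega), hq1 19 16 25 (by norm_num) (by omega),
      hq1 18 16 26 (by norm_num) (by omega), ← hR]
  ring

/-- `N_p = 19` on the cell `26 n < 2p ≤ 28 n`. -/
theorem N_c13 (hA : 26 * n < 2 * p) (hB : 2 * p ≤ 28 * n) : pairFloors (bRay [60, 25, 24, 22, 21, 19, 18, 16] n) p = 19 := by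
  rw [pairFloors_flag (by omega), if_pos (show p ≤ 14 * n by omega), if_pos (show p ≤ 15 * n by omega), if_pos (show p ≤ 16 * n by omega), if_pos (show p ≤ 17 * n by omega), if_pos (show p ≤ 18 * n by omega), if_pos (show p ≤ 19 * n by omega), if_pos (show p ≤ 20 * n by omega), if_pos (show p ≤ 21 * n by omega), if_pos (show p ≤ 22 * n by omega), if_pos (show p ≤ 23 * n by omega), if_pos (show p ≤ 25 * n by omega), if_pos (show p ≤ 26 * n by omega)]; norm_num

/-- `N_p = 17` on the cell `28 n < 2p ≤ 30 n`. -/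
theorem N_c14 (hA : 28 * n < 2 * p) (hB : 2 * p ≤ 30 * n) : pairFloors (bRay [60, 25, 24, 22, 21, 19, 18, 16] n) p = 17 := by
  rw [pairFloors_flag (by omega), if_neg (show ¬ p ≤ 14 * n by omega), if_pos (show p ≤ 15 * n by omega), if_pos (show p ≤ 16 * n by omega), if_pos (show p ≤ 17 * n by omega), if_pos (show p ≤ 18 * n by omega), if_pos (show p ≤ 19 * n by omega), if_pos (show p ≤ 20 * n by omega), if_pos (show p ≤ 21 * n by omega), if_pos (show p ≤ 22 * n by omega), if_pos (show p ≤ 23 * n by omega), if_pos (show p ≤ 25 * n by omega), if_pos (show p ≤ 26 * n by omega)]; norm_num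

/-- `N_p = 16` on the cell `30 n < 2p ≤ 32 n`. -/
theorem N_c15 (hA : 30 * n < 2 * p) (hB : 2 * p ≤ 32 * n) : pairFloors (bRay [60, 25, 24, 22, 21, 19, 18, 16] n) p = 16 := by
  rw [pairFloors_flag (by omega), if_neg (show ¬ p ≤ 14 * n by omega), if_neg (show ¬ p ≤ 15 * n by omega), if_pos (show p ≤ 16 * n by omega), if_pos (show p ≤ 17 * n by omega), if_pos (show p ≤ 18 * n by omega), if_pos (show p ≤ 19 * n by omega), if_pos (show p ≤ 20 * n by omega), if_pos (show p ≤ 21 * n by omega), if_pos (show p ≤ 22 * n by omega), if_pos (show p ≤ 23 * n by omega), if_pos (show p ≤ 25 * n by omega), if_pos (show p ≤ 26 * n by omega)]; norm_num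

/-- `N_p = 15` on the cell `32 n < 2p ≤ 34 n`. -/
theorem N_c16 (hA : 32 * n < 2 * p) (hB : 2 * p ≤ 34 * n) : pairFloors (bRay [60, 25, 24, 22, 21, 19, 18, 16] n) p = 15 := by
  rw [pairFloors_flag (by omega), if_neg (show ¬ p ≤ 14 * n by omega), if_neg (show ¬ p ≤ 15 * n by omega), if_neg (show ¬ p ≤ 16 * n by omega), if_pos (show p ≤ 17 * n by omega), if_pos (show p ≤ 18 * n by omega), if_pos (show p ≤ 19 * n by omega), if_pos (show p ≤ 20 * n by omega), if_pos (show p ≤ 21 * n by omega), if_pos (show p ≤ 22 * n by omega), if_pos (show p ≤ 23 * n by omega), if_pos (show p ≤ 25 * n by omega), if_pos (show p ≤ 26 * n by omega)]; norm_num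

/-- `N_p = 12` on the cell `34 n < 2p ≤ 35 n`. -/
theorem N_c17a (hA : 34 * n < 2 * p) (hB : 2 * p ≤ 35 * n) : pairFloors (bRay [60, 25, 24, 22, 21, 19, 18, 16] n) p = 12 := by
  rw [pairFloors_flag (by omega), if_neg (show ¬ p ≤ 14 * n by omega), if_neg (show ¬ p ≤ 15 * n by omega), if_neg (show ¬ p ≤ 16 * n by omega), if_neg (show ¬ p ≤ 17 * n by omega), if_pos (show p ≤ 18 * n by omega), if_pos (show p ≤ 19 * n by omega), if_pos (show p ≤ 20 * n by omega), if_pos (show p ≤ 21 * n by omega), if_pos (show p ≤ 22 * n by omega), if_pos (show p ≤ 23 * n by omega), if_pos (show p ≤ 25 * n by omega), if_pos (show p ≤ 26 * n by omega)]; norm_num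

/-- `N_p = 12` on the cell `35 n < 2p ≤ 36 n`. -/
theorem N_c17b (hA : 35 * n < 2 * p) (hB : 2 * p ≤ 36 * n) : pairFloors (bRay [60, 25, 24, 22, 21, 19, 18, 16] n) p = 12 := by
  rw [pairFloors_flag (by omega), if_neg (show ¬ p ≤ 14 * n by omega), if_neg (show ¬ p ≤ 15 * n by omega), if_neg (show ¬ p ≤ 16 * n by omega), if_neg (show ¬ p ≤ 17 * n by omega), if_pos (show p ≤ 18 * n by omega), if_pos (show p ≤ 19 * n by omega), if_pos (show p ≤ 20 * n by omega), if_pos (show p ≤ 21 * n by omega), if_pos (show p ≤ 22 * n by omega), if_pos (show p ≤ 23 * n by omega), if_pos (show p ≤ 25 * n by omega), if_pos (show p ≤ 26 * n by omega)]; norm_num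

/-- `N_p = 11` on the cell `36 n < 2p ≤ 38 n`. -/
theorem N_c18 (hA : 36 * n < 2 * p) (hB : 2 * p ≤ 38 * n) : pairFloors (bRay [60, 25, 24, 22, 21, 19, 18, 16] n) p = 11 := by
  rw [pairFloors_flag (by omega), if_neg (show ¬ p ≤ 14 * n by omega), if_neg (show ¬ p ≤ 15 * n by omega), if_neg (show ¬ p ≤ 16 * n by omega), if_neg (show ¬ p ≤ 17 * n by omega), if_neg (show ¬ p ≤ 18 * n by omega), if_pos (show p ≤ 19 * n by omega), if_pos (show p ≤ 20 * n by omega), if_pos (show p ≤ 21 * n by omega), if_pos (show p ≤ 22 * n by omega), if_pos (show p ≤ 23 * n by omega), if_pos (show p ≤ 25 * n by omega), if_pos (show p ≤ 26 * n by omega)]; norm_num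

/-- `N_p = 9` on the cell `38 n < 2p ≤ 40 n`. -/
theorem N_c19 (hA : 38 * n < 2 * p) (hB : 2 * p ≤ 40 * n) : pairFloors (bRay [60, 25, 24, 22, 21, 19, 18, 16] n) p = 9 := by
  rw [pairFloors_flag (by omega), if_neg (show ¬ p ≤ 14 * n by omega), if_neg (show ¬ p ≤ 15 * n by omega), if_neg (show ¬ p ≤ 16 * n by omega), if_neg (show ¬ p ≤ 17 * n by omega), if_neg (show ¬ p ≤ 18 * n by omega), if_neg (show ¬ p ≤ 19 * n by omega), if_pos (show p ≤ 20 * n by omega), if_pos (show p ≤ 21 * n by omega), if_pos (show p ≤ 22 * n by omega), if_pos (show p ≤ 23 * n by omega), if_pos (show p ≤ 25 * n by omega), if_pos (show p ≤ 26 * n by omega)]; norm_num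

/-- `N_p = 6` on the cell `40 n < 2p ≤ 42 n`. -/
theorem N_c20 (hA : 40 * n < 2 * p) (hB : 2 * p ≤ 42 * n) : pairFloors (bRay [60, 25, 24, 22, 21, 19, 18, 16] n) p = 6 := by
  rw [pairFloors_flag (by omega), if_neg (show ¬ p ≤ 14 * n by omega), if_neg (show ¬ p ≤ 15 * n by omega), if_neg (show ¬ p ≤ 16 * n by omega), if_neg (show ¬ p ≤ 17 * n by omega), if_neg (show ¬ p ≤ 18 * n by omega), if_neg (show ¬ p ≤ 19 * n by omega), if_neg (show ¬ p ≤ 20 * n by omega), if_pos (show p ≤ 21 * n by omega), if_pos (show p ≤ 22 * n by omega), if_pos (show p ≤ 23 * n by omega), if_pos (show p ≤ 25 * n by omega), if_pos (show p ≤ 26 * n by omega)]; norm_num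

/-- `N_p = 5` on the cell `42 n < 2p ≤ 44 n`. -/
theorem N_c21 (hA : 42 * n < 2 * p) (hB : 2 * p ≤ 44 * n) : pairFloors (bRay [60, 25, 24, 22, 21, 19, 18, 16] n) p = 5 := by
  rw [pairFloors_flag (by omega), if_neg (show ¬ p ≤ 14 * n by omega), if_neg (show ¬ p ≤ 15 * n by omega), if_neg (show ¬ p ≤ 16 * n by omega), if_neg (show ¬ p ≤ 17 * n by omega), if_neg (show ¬ p ≤ 18 * n by omega), if_neg (show ¬ p ≤ 19 * n by omega), if_neg (show ¬ p ≤ 20 * n by omega), if_neg (show ¬ p ≤ 21 * n by omega), if_pos (show p ≤ 22 * n by omega), if_pos (show p ≤ 23 * n by omega), if_pos (show p ≤ 25 * n by omega), if_pos (show p ≤ 26 * n by omega)]; norm_num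

/-- `N_p = 4` on the cell `44 n < 2p ≤ 46 n`. -/
theorem N_c22 (hA : 44 * n < 2 * p) (hB : 2 * p ≤ 46 * n) : pairFloors (bRay [60, 25, 24, 22, 21, 19, 18, 16] n) p = 4 := by
  rw [pairFloors_flag (by omega), if_neg (show ¬ p ≤ 14 * n by omega), if_neg (show ¬ p ≤ 15 * n by omega), if_neg (show ¬ p ≤ 16 * n by omega), if_neg (show ¬ p ≤ 17 * n by omega), if_neg (show ¬ p ≤ 18 * n by omega), if_neg (show ¬ p ≤ 19 * n by omega), if_neg (show ¬ p ≤ 20 * n by omega), if_neg (show ¬ p ≤ 21 * n by omega), if_neg (show ¬ p ≤ 22 * n by omega), if_pos (show p ≤ 23 * n by omega), if_pos (show p ≤ 25 * n by omega), if_pos (show p ≤ 26 * n by omega)]; norm_num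

/-- `N_p = 2` on the cell `46 n < 2p ≤ 50 n`. -/
theorem N_c23 (hA : 46 * n < 2 * p) (hB : 2 * p ≤ 50 * n) : pairFloors (bRay [60, 25, 24, 22, 21, 19, 18, 16] n) p = 2 := by
  rw [pairFloors_flag (by omega), if_neg (show ¬ p ≤ 14 * n by omega), if_neg (show ¬ p ≤ 15 * n by omega), if_neg (show ¬ p ≤ 16 * n by omega), if_neg (show ¬ p ≤ 17 * n by omega), if_neg (show ¬ p ≤ 18 * n by omega), if_neg (show ¬ p ≤ 19 * n by omega), if_neg (show ¬ p ≤ 20 * n by omega), if_neg (show ¬ p ≤ 21 * n by omega), if_neg (show ¬ p ≤ 22 * n by omega), if_neg (show ¬ p ≤ 23 * n by omega), if_pos (show p ≤ 25 * n by omega), if_pos (show p ≤ 26 * n by omega)]; norm_num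

/-- `N_p = 1` on the cell `50 n < 2p ≤ 52 n`. -/
theorem N_c25 (hA : 50 * n < 2 * p) (hB : 2 * p ≤ 52 * n) : pairFloors (bRay [60, 25, 24, 22, 21, 19, 18, 16] n) p = 1 := by
  rw [pairFloors_flag (by omega), if_neg (show ¬ p ≤ 14 * n by omega), if_neg (show ¬ p ≤ 15 * n by omega), if_neg (show ¬ p ≤ 16 * n by omega), if_neg (show ¬ p ≤ 17 * n by omega), if_neg (show ¬ p ≤ 18 * n by omega), if_neg (show ¬ p ≤ 19 * n by omega), if_neg (show ¬ p ≤ 20 * n by omega), if_neg (show ¬ p ≤ 21 * n by omega), if_neg (show ¬ p ≤ 22 * n by omega), if_neg (show ¬ p ≤ 23 * n by omega), if_neg (show ¬ p ≤ 25 * n by omega), if_pos (show p ≤ 26 * n by omega)]; norm_num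

/-- `N_p = 0` on the cell `52 n < 2p ≤ 70 n`. -/
theorem N_c26 (hA : 52 * n < 2 * p) (hB : 2 * p ≤ 70 * n) : pairFloors (bRay [60, 25, 24, 22, 21, 19, 18, 16] n) p = 0 := by
  rw [pairFloors_flag (by omega), if_neg (show ¬ p ≤ 14 * n by omega), if_neg (show ¬ p ≤ 15 * n by omega), if_neg (show ¬ p ≤ 16 * n by omega), if_neg (show ¬ p ≤ 17 * n by omega), if_neg (show ¬ p ≤ 18 * n by omega), if_neg (show ¬ p ≤ 19 * n by omega), if_neg (show ¬ p ≤ 20 * n by omega), if_neg (show ¬ p ≤ 21 * n by omega), if_neg (show ¬ p ≤ 22 * n by omega), if_neg (show ¬ p ≤ 23 * n by omega), if_neg (show ¬ p ≤ 25 * n by omega), if_neg (show ¬ p ≤ 26 * n by omega)]; norm_num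

/-- `N_p = 0` on the cell `70 n < 2p`. -/
theorem N_c35 (hA : 70 * n < 2 * p) : pairFloors (bRay [60, 25, 24, 22, 21, 19, 18, 16] n) p = 0 := by
  rw [pairFloors_flag (by omega), if_neg (show ¬ p ≤ 14 * n by omega), if_neg (show ¬ p ≤ 15 * n by omega), if_neg (show ¬ p ≤ 16 * n by omega), if_neg (show ¬ p ≤ 17 * n by omega), if_neg (show ¬ p ≤ 18 * n by omega), if_neg (show ¬ p ≤ 19 * n by omega), if_neg (show ¬ p ≤ 20 * n by omega), if_neg (show ¬ p ≤ 21 * n by omega), if_neg (show ¬ p ≤ 22 * n by omega), if_neg (show ¬ p ≤ 23 * n by omega), if_neg (show ¬ p ≤ 25 * n by omega), if_neg (show ¬ p ≤ 26 * n by omega)]; norm_num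
end Arith

/-! ## §3 Dominance for `p > 13n` off the band, and (CV) for `p > 13n` -/

/-- A prime is odd once `p > 13n ≥ 13`... more precisely once `p ≥ 3`. -/
theorem odd_of_prime_gt {n p : ℕ} (hprime : p.Prime) (h13 : 13 * n < p) (hn : 1 ≤ n) : p % 2 = 1 :=
  Nat.odd_iff.1 (hprime.odd_of_ne_two (by omega))

/-- **DOMINANCE on the first-period flag ray off the band**: `refund − N_p ≤ casLB(b(n),p)` for every `n ≥ 1` and every prime `p > 13n` outside
`21n < p < 22n` (there the left side is `−4` and `casLB = −5`). -/
theorem flag_dominance {n p : ℕ} (hn : 1 ≤ n) (hprime : p.Prime) (h13 : 13 * n < p) (hband : ¬ (21 * n < p ∧ p < 22 * n)) :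
    refund (bRay [60, 25, 24, 22, 21, 19, 18, 16] n) p - pairFloors (bRay [60, 25, 24, 22, 21, 19, 18, 16] n) p
      ≤ casLB (bRay [60, 25, 24, 22, 21, 19, 18, 16] n) p := by
  haveI : Fact p.Prime := ⟨hprime⟩
  have hp0 : 0 < p := hprime.pos
  have hp2 := odd_of_prime_gt hprime h13 hn
  by_cases h60 : 60 * n < p
  · rw [refund_ray_zero (by omega), N_c35 (by omega)]
    linarith [casLB_gt60 (n := n) h60]
  by_cases h35 : 35 * n < p
  · rw [refund_ray_zero h35, N_c35 (by omega)]
    linarith [casLB_c35 (n := n) (p := p) (by omega) (by omega) hp2]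
  push Not at h35
  rw [refund_ray_one hp0 h35]
  by_cases h : 2 * p ≤ 28 * n
  · rw [N_c13 (by omega) h]; linarith [casLB_c13 (n := n) (p := p) (by omega) h hp2]
  by_cases h' : 2 * p ≤ 30 * n
  · rw [N_c14 (by omega) h']; linarith [casLB_c14 (n := n) (p := p) (by omega) h' hp2]
  by_cases h : 2 * p ≤ 32 * n
  · rw [N_c15 (by omega) h]; linarith [casLB_c15 (n := n) (p := p) (by omega) h hp2]
  by_cases h' : 2 * p ≤ 34 * n
  · rw [N_c16 (by omega) h']; linarith [casLB_c16 (n := n) (p := p) (by omega) h' hp2]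
  by_cases h : 2 * p ≤ 35 * n
  · rw [N_c17a (by omega) h]; linarith [casLB_c17a (n := n) (p := p) (by omega) h hp2]
  by_cases h' : 2 * p ≤ 36 * n
  · rw [N_c17b (by omega) h']; linarith [casLB_c17b (n := n) (p := p) (by omega) h' hp2]
  by_cases h : 2 * p ≤ 38 * n
  · rw [N_c18 (by omega) h]; linarith [casLB_c18 (n := n) (p := p) (by omega) h hp2]
  by_cases h' : 2 * p ≤ 40 * n
  · rw [N_c19 (by omega) h']; linarith [casLB_c19 (n := n) (p := p) (by omega) h' hp2]
  by_cases h : 2 * p ≤ 42 * n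
  · rw [N_c20 (by omega) h]; linarith [casLB_c20 (n := n) (p := p) (by omega) h hp2]
  -- the band `21n < p < 22n` is excluded; `p = 22n` is even
  have h44 : 44 * n < 2 * p := by omega
  by_cases h' : 2 * p ≤ 46 * n
  · rw [N_c22 h44 h']; linarith [casLB_c22 (n := n) (p := p) h44 h' hp2]
  by_cases h : 2 * p ≤ 50 * n
  · rw [N_c23 (by omega) h]; linarith [casLB_c23 (n := n) (p := p) (by omega) h hp2]
  by_cases h' : 2 * p ≤ 52 * n
  · rw [N_c25 (by omega) h']; linarith [casLB_c25 (n := n) (p := p) (by omega) h' hp2]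
  · rw [N_c26 (by omega) (by omega)]; linarith [casLB_c26 (n := n) (p := p) (by omega) (by omega) hp2]

/-- **The double-drop bonus for any direction `j`** (`StairCoverKit.cover_B` with `7 ↦ j`): `c ≤ v_p(Cas_j(b))` from a cover, `checkLB` at
`(−N, B)` with `c ≤ −N + B + 2`, `checkB` at `N` (`N ≥ 3` even), and the fallback `checkLBx` at `(−N; A', B')` with `c ≤ A' + B'`. -/
theorem cover_B_j {b : ℕ → ℤ} {p j : ℕ} (hb : InPolytope b) (hj1 : 1 ≤ j) (hj7 : j ≤ 7) (hb' : InPolytope (shift b j)) (hpr : p.Prime)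
    (hp5 : 5 ≤ p) (hpb : (p : ℤ) ≤ b 0) (hpd : (p : ℤ) ≤ dOf b) (hwin : (b 0 + 2 : ℤ) < (p : ℤ) ^ 2)
    {TY : List (List ℤ × Bool)} (hcov : Cover b p TY) {N : ℕ} (hN : 3 ≤ N) (hNe : Even N) {B A' B' c : ℤ}
    (hLB : checkLB (decide (¬ (2 : ℤ) ∣ b 0)) TY (-(N : ℤ)) B = true) (hB1 : B ≤ 1)
    (hchkB : checkB (decide (¬ (2 : ℤ) ∣ b 0)) TY N = true)
    (hLBx : checkLBx (decide (¬ (2 : ℤ) ∣ b 0)) TY (-(N : ℤ)) A' B' = true) (hB1' : B' ≤ 1)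
    (hc : c ≤ -(N : ℤ) + B + 2) (hc' : c ≤ A' + B') (hc0 : c ≤ 0)
    (hne : casoratian b j ≠ 0) : c ≤ padicValRat p (casoratian b j) := by
  haveI : Fact p.Prime := ⟨hpr⟩
  have hv := casoratianClassBound_holds b j p hb hj1 hj7 hb' hpr hp5 hwin hne
  by_cases hreal : ∃ x, x < p ∧ 2 ≤ classPoleCount b p x ∧ classExp b p x = -(N : ℤ)
  · have hB' := doubleDrop_of_cover hb hj1 hj7 hb' hpr hp5 hpb hpd hwin hcov hN hNe hchkB hreal hne
    rcases casLB_ge_of_cover hcov hLB hB1 hpd with h0 | h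
    · rw [h0] at hv; exact le_trans (by exact_mod_cast hc0) hv
    · linarith
  · rcases casLB_ge_of_cover_x hcov hLBx hB1' hpd hreal with h0 | h
    · rw [h0] at hv; exact le_trans (by exact_mod_cast hc0) hv
    · linarith

/-- **The band `21n < p < 22n`, any direction `j`**: `v_p(Cas_j(b(n))) ≥ −3 ≥ refund − N_p = −4`, by the double-drop bonus read on the tree's cover
`StairFLAG.cover_a` / `check_a` (the tree's `cell_a` is the case `j = 7`). -/
theorem band_cas_ge {n j p : ℕ} (hn : 1 ≤ n) (hj1 : 1 ≤ j) (hj7 : j ≤ 7) (hprime : p.Prime) (hA : 21 * n < p) (hB : p < 22 * n)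
    (hcas : casoratian (bRay [60, 25, 24, 22, 21, 19, 18, 16] n) j ≠ 0) :
    (-3 : ℤ) ≤ padicValRat p (casoratian (bRay [60, 25, 24, 22, 21, 19, 18, 16] n) j) := by
  haveI : Fact p.Prime := ⟨hprime⟩
  have hp2 : p % 2 = 1 := Nat.odd_iff.1 (hprime.odd_of_ne_two (by omega))
  obtain ⟨hp5, hpb, hpd, hwin⟩ := window (n := n) (p := p) (by omega) (by omega)
  obtain ⟨h1, h2, h3⟩ := check_a (decide (¬ (2 : ℤ) ∣ bRay [60, 25, 24, 22, 21, 19, 18, 16] n 0))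
  exact cover_B_j (inPolytope_ray n) hj1 hj7 (inPolytope_shift_ray_j hn j hj1 hj7) hprime hp5 hpb hpd hwin (cover_a hA hB hp2) (N := 4)
    (by norm_num) (by decide) h1 (by norm_num) h2 h3 (by norm_num) (by norm_num) (by norm_num) (by norm_num) hcas

/-- **(CV) ON THE FIRST-PERIOD FLAG RAY, every direction `j`, all `n`**: for `n ≥ 1`, `1 ≤ j ≤ 7`, every prime `p > 13n` and `Cas_j(b(n)) ≠ 0`,
`refund − N_p ≤ v_p(Cas_j(b(n)))` — dominance + THEOREM LB off the band, the double-drop bonus on the band. -/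
theorem flagRayCV_gt13 (n j p : ℕ) (hn : 1 ≤ n) (hj1 : 1 ≤ j) (hj7 : j ≤ 7) (hprime : p.Prime) (h13 : 13 * n < p)
    (hcas : casoratian (bRay [60, 25, 24, 22, 21, 19, 18, 16] n) j ≠ 0) :
    refund (bRay [60, 25, 24, 22, 21, 19, 18, 16] n) p - pairFloors (bRay [60, 25, 24, 22, 21, 19, 18, 16] n) p
      ≤ padicValRat p (casoratian (bRay [60, 25, 24, 22, 21, 19, 18, 16] n) j) := by
  by_cases hband : 21 * n < p ∧ p < 22 * n
  · rw [refund_ray_one hprime.pos (by omega), N_c21 (by omega) (by omega)]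
    linarith [band_cas_ge hn hj1 hj7 hprime hband.1 hband.2 hcas]
  · exact (flag_dominance hn hprime h13 hband).trans (cas_ge_casLB hn hj1 hj7 hprime h13 hcas)

end Summit.KontsevichZagierPeriods.Zeta5Search.StairFLAG
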